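import Literature.Geometry.Lorentzian.KerrDeSitterTeukolskyRadial
import HarnessLib

/-!
# Half-integer spin `|s| = 3/2` on the real axis, I: the polynomial data of the
# Teukolsky–Starobinsky conserved form (generic even quartic) and the four identities behind
# its conservation

HONEST LABEL. Pure algebra: four explicit polynomials `p₁₁, Re p₁₂, Im p₁₂, p₂₂` in `r` with
coefficients in the data `(d₀, d₁, d₂, d₄, k₀, k₂, λ̃)` of an even-dominated quartic
`Δ = d₀ + d₁r + d₂r² + d₄r⁴` and an even quadratic `K̃ = k₀ + k₂r²`, their `r`-derivatives, and four
polynomial identities (P1), (P2re), (P2im), (P3) proved by `ring`. The companion file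
`KerrDeSitterRadialTSFormThreeHalves.lean` turns them into the conservation law of the spin-`3/2`
Teukolsky–Starobinsky form along real-frequency solutions of the Kerr–de Sitter radial equation.
No statement about radial solutions, horizons or modes is made here. Definitions with bodies +
theorems, NO named facts.

Sources read verbatim (held texts; page/line of the materialised pages):
* [WuYan2004] S.-Q. Wu, M.-L. Yan, Phys. Rev. D 69 (2004) 044019, arXiv:gr-qc/0303076, Appendix A
  (p. 14 l. 7–35): the Kerr–de Sitter radial operators `𝒟_n = ∂_r − iΞK/Δ_r + nΔ_r'/Δ_r`,
  `𝒟_n† = ∂_r + iΞK/Δ_r + nΔ_r'/Δ_r`, the radial equations (A3) (spin `+s`) and (A4) (spin `−s`),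
  and the Teukolsky–Starobinsky identities (A5): `𝒟₀^{2s}` maps solutions of (A4) to solutions of
  (A3) (direction `R_{−s} ↦ Δ_r^s R_s`).
* [SuzukiTakasugiUmetsu1998] H. Suzuki, E. Takasugi, H. Umetsu, Prog. Theor. Phys. 100 (1998)
  491–505, (3.7): the radial Teukolsky equation of Kerr–de Sitter (the tree's `radialPotential`).

## Where the polynomials come from (what the definitions encode)

For an even-dominated quartic `Δ` and even quadratic `K̃` (on Kerr–de Sitter: `Δ = Δ_r` with
`d₀ = a²`, `d₁ = −2M`, `d₂ = 1 − Λa²/3`, `d₄ = −Λ/3`, and `K̃ = ΞK`, `k₀ = Ξ(ωa² − am)`, `k₂ = Ξω`)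
the spin-`3/2` radial coefficient at REAL `ω`, `λ` is `V = N_V/Δ` with
`N_V = K̃² − (3i/2)K̃Δ′ + Δ·(3iK̃′ + (5/3)Δ″ − λ̃)` (`tsqNVre`, `tsqNVim`; on Kerr–de Sitter
`λ̃ = λ + (1 − α)/3`, companion file). If `R` solves `ΔR″ + (5/2)Δ′R′ + VR = 0` then
`u := Δ^{3/2} conj R` solves the spin-`(−3/2)` equation and `R̂ := 𝒟₀³u`, `𝒟₀ = ∂_r − iK̃/Δ`,
solves the spin-`(+3/2)` equation again (Wu–Yan (A4), (A5)); reducing `R̂` modulo the equation,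
Abel's invariant `W := Δ^{5/2}(R R̂′ − R′R̂)` becomes the Hermitian form
`W = p₁₁|R|² + 2 Re(Δp₁₂ R conj R′) + Δ²p₂₂|R′|²` whose coefficients are the polynomials below
(obtained once and for all by carrying the `𝒟₀`-chain out symbolically; the kernel re-checks
everything that is used: `W′ = 0` along solutions is EQUIVALENT to the four identities
  (P1)  `Δ·p₁₁′ = 2(Re p₁₂·Re N_V + Im p₁₂·Im N_V)`,
  (P2)  `p₁₁ + Δ·p₁₂′ = (3/2)Δ′·p₁₂ + p₂₂·N_V` (real and imaginary parts),
  (P3)  `2 Re p₁₂ + Δ·p₂₂′ = 3Δ′·p₂₂`,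
which are `tsq_identity_P1/P2re/P2im/P3`). Only `deg Δ ≤ 4`, `deg K̃ ≤ 2` is used; Kerr is
`d₄ = 0`. CONTROL `s = 1/2`: the same chain with one `𝒟₀` step returns the coefficients
`λΔ − Δ′²/4 − K̃²`, `−Δ(Δ′/2 − iK̃)`, `−Δ²` of the form `Q` of `KerrDeSitterFermionicRealAxis.lean`.
-/

noncomputable section

open Complex Set

namespace Literature.Geometry.Lorentzian.KerrDeSitter

/-! ### Generic data: an even-dominated quartic `Δ` and an even quadratic `K̃` -/

/-- The even-dominated quartic `Δ(r) = d₀ + d₁r + d₂r² + d₄r⁴` (no cubic term: the four roots of the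
Kerr–de Sitter horizon function sum to zero). [cite: Hatsuda2020, (2.13)] -/
def tsqDelta (d₀ d₁ d₂ d₄ r : ℝ) : ℝ := d₀ + d₁ * r + d₂ * r ^ 2 + d₄ * r ^ 4

/-- `Δ′(r) = d₁ + 2d₂r + 4d₄r³`. [cite: Hatsuda2020, (2.13)] -/
def tsqDeltaD (d₁ d₂ d₄ r : ℝ) : ℝ := d₁ + 2 * d₂ * r + 4 * d₄ * r ^ 3

/-- `Δ″(r) = 2d₂ + 12d₄r²`. [cite: Hatsuda2020, (2.13)] -/
def tsqDeltaDD (d₂ d₄ r : ℝ) : ℝ := 2 * d₂ + 12 * d₄ * r ^ 2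

/-- The even quadratic `K̃(r) = k₀ + k₂r²` (on Kerr–de Sitter `K̃ = ΞK = Ξ(ω(r²+a²) − am)`).
[cite: Hatsuda2020, (2.14)] -/
def tsqK (k₀ k₂ r : ℝ) : ℝ := k₀ + k₂ * r ^ 2

/-- Real part of the numerator `N_V = Δ·V` of the spin-`3/2` radial coefficient:
`Re N_V = K̃² + Δ·((5/3)Δ″ − λ̃)`. [cite: SuzukiTakasugiUmetsu1998, (3.7)] -/
def tsqNVre (d₀ d₁ d₂ d₄ k₀ k₂ el r : ℝ) : ℝ :=
  tsqK k₀ k₂ r ^ 2 + tsqDelta d₀ d₁ d₂ d₄ r * (5 / 3 * tsqDeltaDD d₂ d₄ r - el)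

/-- Imaginary part of the numerator `N_V = Δ·V` of the spin-`3/2` radial coefficient:
`Im N_V = −(3/2)K̃Δ′ + 3ΔK̃′`, `K̃′ = 2k₂r`. [cite: SuzukiTakasugiUmetsu1998, (3.7)] -/
def tsqNVim (d₀ d₁ d₂ d₄ k₀ k₂ r : ℝ) : ℝ :=
  -(3 / 2) * tsqK k₀ k₂ r * tsqDeltaD d₁ d₂ d₄ r + tsqDelta d₀ d₁ d₂ d₄ r * (3 * (2 * k₂ * r))

/-! ### The four polynomials of the form (generated once by the `𝒟₀`-chain; checked below) -/

/-- **`p₂₂`** — the `|R′|²`-coefficient of the spin-`3/2` Teukolsky–Starobinsky form is `Δ²·p₂₂`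
(degree 4 in `r`; explicit polynomial in the coefficients of `Δ`, `K̃` and in `λ̃`, produced by
Wu–Yan's `𝒟₀`-chain, see the module docstring). [cite: WuYan2004, Appendix A, (A5)] -/
def tsqP22 (d₀ d₁ d₂ d₄ k₀ k₂ el r : ℝ) : ℝ :=
  (-(2 / 3 : ℝ) * d₀ * d₂ - d₀ * el + (1 / 4 : ℝ) * d₁ ^ 2 + 4 * k₀ ^ 2) + ((1 / 3 : ℝ) * d₁ * d₂ -
    d₁ * el) * r + (-4 * d₀ * d₄ + (1 / 3 : ℝ) * d₂ ^ 2 - d₂ * el + 8 * k₀ * k₂) * r ^ 2 +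
    (-2 * d₁ * d₄) * r ^ 3 + (-(2 / 3 : ℝ) * d₂ * d₄ - d₄ * el + 4 * k₂ ^ 2) * r ^ 4

/-- The `r`-derivative of `tsqP22`, written out as a polynomial (`hasDerivAt_tsqP22`). [cite:
WuYan2004, Appendix A, (A5)] -/
def tsqP22d (d₀ d₁ d₂ d₄ k₀ k₂ el r : ℝ) : ℝ :=
  ((1 / 3 : ℝ) * d₁ * d₂ - d₁ * el) + 2 * (-4 * d₀ * d₄ + (1 / 3 : ℝ) * d₂ ^ 2 - d₂ * el +
    8 * k₀ * k₂) * r + 3 * (-2 * d₁ * d₄) * r ^ 2 + 4 * (-(2 / 3 : ℝ) * d₂ * d₄ - d₄ * el +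
    4 * k₂ ^ 2) * r ^ 3

/-- **`Re p₁₂`** — the `R·conj R′`-coefficient of the spin-`3/2` Teukolsky–Starobinsky form is
`Δ·p₁₂`, `p₁₂ = Re p₁₂ + i·Im p₁₂` (degree 7 in `r`). [cite: WuYan2004, Appendix A, (A5)] -/
def tsqP12re (d₀ d₁ d₂ d₄ k₀ k₂ el r : ℝ) : ℝ :=
  (-(7 / 6 : ℝ) * d₀ * d₁ * d₂ - d₀ * d₁ * el + (3 / 8 : ℝ) * d₁ ^ 3 + 6 * d₁ * k₀ ^ 2) +
    (4 * d₀ ^ 2 * d₄ - (7 / 3 : ℝ) * d₀ * d₂ ^ 2 - 2 * d₀ * d₂ * el - 8 * d₀ * k₀ * k₂ +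
    (13 / 12 : ℝ) * d₁ ^ 2 * d₂ - d₁ ^ 2 * el + 12 * d₂ * k₀ ^ 2) * r + (d₀ * d₁ * d₄ +
    d₁ * d₂ ^ 2 - 3 * d₁ * d₂ * el + 4 * d₁ * k₀ * k₂) * r ^ 2 + (-(32 / 3 : ℝ) * d₀ * d₂ * d₄ -
    4 * d₀ * d₄ * el - 8 * d₀ * k₂ ^ 2 + (3 / 2 : ℝ) * d₁ ^ 2 * d₄ + (2 / 3 : ℝ) * d₂ ^ 3 -
    2 * d₂ ^ 2 * el + 16 * d₂ * k₀ * k₂ + 24 * d₄ * k₀ ^ 2) * r ^ 3 + (-(5 / 6 : ℝ) * d₁ * d₂ * d₄ -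
    5 * d₁ * d₄ * el - 2 * d₁ * k₂ ^ 2) * r ^ 4 + (-20 * d₀ * d₄ ^ 2 + d₂ ^ 2 * d₄ -
    6 * d₂ * d₄ * el + 4 * d₂ * k₂ ^ 2 + 40 * d₄ * k₀ * k₂) * r ^ 5 + (-9 * d₁ * d₄ ^ 2) * r ^ 6 +
    (-(8 / 3 : ℝ) * d₂ * d₄ ^ 2 - 4 * d₄ ^ 2 * el + 16 * d₄ * k₂ ^ 2) * r ^ 7

/-- The `r`-derivative of `tsqP12re`, written out as a polynomial (`hasDerivAt_tsqP12re`). [cite: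
WuYan2004, Appendix A, (A5)] -/
def tsqP12red (d₀ d₁ d₂ d₄ k₀ k₂ el r : ℝ) : ℝ :=
  (4 * d₀ ^ 2 * d₄ - (7 / 3 : ℝ) * d₀ * d₂ ^ 2 - 2 * d₀ * d₂ * el - 8 * d₀ * k₀ * k₂ +
    (13 / 12 : ℝ) * d₁ ^ 2 * d₂ - d₁ ^ 2 * el + 12 * d₂ * k₀ ^ 2) + 2 * (d₀ * d₁ * d₄ +
    d₁ * d₂ ^ 2 - 3 * d₁ * d₂ * el + 4 * d₁ * k₀ * k₂) * r + 3 * (-(32 / 3 : ℝ) * d₀ * d₂ * d₄ -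
    4 * d₀ * d₄ * el - 8 * d₀ * k₂ ^ 2 + (3 / 2 : ℝ) * d₁ ^ 2 * d₄ + (2 / 3 : ℝ) * d₂ ^ 3 -
    2 * d₂ ^ 2 * el + 16 * d₂ * k₀ * k₂ + 24 * d₄ * k₀ ^ 2) * r ^ 2 +
    4 * (-(5 / 6 : ℝ) * d₁ * d₂ * d₄ - 5 * d₁ * d₄ * el - 2 * d₁ * k₂ ^ 2) * r ^ 3 +
    5 * (-20 * d₀ * d₄ ^ 2 + d₂ ^ 2 * d₄ - 6 * d₂ * d₄ * el + 4 * d₂ * k₂ ^ 2 +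
    40 * d₄ * k₀ * k₂) * r ^ 4 + 6 * (-9 * d₁ * d₄ ^ 2) * r ^ 5 + 7 * (-(8 / 3 : ℝ) * d₂ * d₄ ^ 2 -
    4 * d₄ ^ 2 * el + 16 * d₄ * k₂ ^ 2) * r ^ 6

/-- **`Im p₁₂`** — imaginary part of the `R·conj R′`-coefficient `Δ·p₁₂` of the spin-`3/2`
Teukolsky–Starobinsky form (degree 6 in `r`). [cite: WuYan2004, Appendix A, (A5)] -/
def tsqP12im (d₀ d₁ d₂ d₄ k₀ k₂ el r : ℝ) : ℝ :=
  (4 * d₀ ^ 2 * k₂ - 3 * d₀ * k₀ * el + (1 / 4 : ℝ) * d₁ ^ 2 * k₀ + 4 * k₀ ^ 3) +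
    (6 * d₀ * d₁ * k₂ + d₁ * d₂ * k₀ - 3 * d₁ * k₀ * el) * r + (4 * d₀ * d₂ * k₂ -
    3 * d₀ * k₂ * el + (9 / 4 : ℝ) * d₁ ^ 2 * k₂ + d₂ ^ 2 * k₀ - 3 * d₂ * k₀ * el +
    12 * k₀ ^ 2 * k₂) * r ^ 2 + (3 * d₁ * d₂ * k₂ + 2 * d₁ * d₄ * k₀ - 3 * d₁ * k₂ * el) * r ^ 3 +
    (d₂ ^ 2 * k₂ + 4 * d₂ * d₄ * k₀ - 3 * d₂ * k₂ * el - 3 * d₄ * k₀ * el +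
    12 * k₀ * k₂ ^ 2) * r ^ 4 + (0) * r ^ 5 + (4 * d₄ ^ 2 * k₀ - 3 * d₄ * k₂ * el +
    4 * k₂ ^ 3) * r ^ 6

/-- The `r`-derivative of `tsqP12im`, written out as a polynomial (`hasDerivAt_tsqP12im`). [cite:
WuYan2004, Appendix A, (A5)] -/
def tsqP12imd (d₀ d₁ d₂ d₄ k₀ k₂ el r : ℝ) : ℝ :=
  (6 * d₀ * d₁ * k₂ + d₁ * d₂ * k₀ - 3 * d₁ * k₀ * el) + 2 * (4 * d₀ * d₂ * k₂ - 3 * d₀ * k₂ * el +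
    (9 / 4 : ℝ) * d₁ ^ 2 * k₂ + d₂ ^ 2 * k₀ - 3 * d₂ * k₀ * el + 12 * k₀ ^ 2 * k₂) * r +
    3 * (3 * d₁ * d₂ * k₂ + 2 * d₁ * d₄ * k₀ - 3 * d₁ * k₂ * el) * r ^ 2 + 4 * (d₂ ^ 2 * k₂ +
    4 * d₂ * d₄ * k₀ - 3 * d₂ * k₂ * el - 3 * d₄ * k₀ * el + 12 * k₀ * k₂ ^ 2) * r ^ 3 +
    5 * (0) * r ^ 4 + 6 * (4 * d₄ ^ 2 * k₀ - 3 * d₄ * k₂ * el + 4 * k₂ ^ 3) * r ^ 5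

/-- **`p₁₁`** — the `|R|²`-coefficient of the spin-`3/2` Teukolsky–Starobinsky form (degree 10 in
`r`). [cite: WuYan2004, Appendix A, (A5)] -/
def tsqP11 (d₀ d₁ d₂ d₄ k₀ k₂ el r : ℝ) : ℝ :=
  (-4 * d₀ ^ 3 * d₄ + (1 / 9 : ℝ) * d₀ ^ 2 * d₂ ^ 2 - (2 / 3 : ℝ) * d₀ ^ 2 * d₂ * el +
    8 * d₀ ^ 2 * k₀ * k₂ + d₀ ^ 2 * el ^ 2 - 2 * d₀ * d₁ ^ 2 * d₂ - (3 / 4 : ℝ) * d₀ * d₁ ^ 2 * el +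
    (2 / 3 : ℝ) * d₀ * d₂ * k₀ ^ 2 - 5 * d₀ * k₀ ^ 2 * el + (9 / 16 : ℝ) * d₁ ^ 4 +
    (37 / 4 : ℝ) * d₁ ^ 2 * k₀ ^ 2 + 4 * k₀ ^ 4) + (-(70 / 9 : ℝ) * d₀ * d₁ * d₂ ^ 2 -
    (13 / 3 : ℝ) * d₀ * d₁ * d₂ * el - 12 * d₀ * d₁ * k₀ * k₂ + 2 * d₀ * d₁ * el ^ 2 +
    (5 / 2 : ℝ) * d₁ ^ 3 * d₂ - (3 / 4 : ℝ) * d₁ ^ 3 * el + (113 / 3 : ℝ) * d₁ * d₂ * k₀ ^ 2 -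
    5 * d₁ * k₀ ^ 2 * el) * r + ((40 / 3 : ℝ) * d₀ ^ 2 * d₂ * d₄ - 4 * d₀ ^ 2 * d₄ * el +
    24 * d₀ ^ 2 * k₂ ^ 2 - (70 / 9 : ℝ) * d₀ * d₂ ^ 3 - (13 / 3 : ℝ) * d₀ * d₂ ^ 2 * el -
    (116 / 3 : ℝ) * d₀ * d₂ * k₀ * k₂ + 2 * d₀ * d₂ * el ^ 2 + 4 * d₀ * d₄ * k₀ ^ 2 -
    10 * d₀ * k₀ * k₂ * el + (65 / 18 : ℝ) * d₁ ^ 2 * d₂ ^ 2 - (53 / 12 : ℝ) * d₁ ^ 2 * d₂ * el -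
    (3 / 2 : ℝ) * d₁ ^ 2 * k₀ * k₂ + d₁ ^ 2 * el ^ 2 + (113 / 3 : ℝ) * d₂ ^ 2 * k₀ ^ 2 -
    5 * d₂ * k₀ ^ 2 * el + 16 * k₀ ^ 3 * k₂) * r ^ 2 + (-(40 / 3 : ℝ) * d₀ * d₁ * d₂ * d₄ -
    14 * d₀ * d₁ * d₄ * el + 20 * d₀ * d₁ * k₂ ^ 2 + 5 * d₁ ^ 3 * d₄ + (20 / 9 : ℝ) * d₁ * d₂ ^ 3 -
    (22 / 3 : ℝ) * d₁ * d₂ ^ 2 * el + (22 / 3 : ℝ) * d₁ * d₂ * k₀ * k₂ + 2 * d₁ * d₂ * el ^ 2 +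
    78 * d₁ * d₄ * k₀ ^ 2 - 10 * d₁ * k₀ * k₂ * el) * r ^ 3 + (40 * d₀ ^ 2 * d₄ ^ 2 -
    (370 / 9 : ℝ) * d₀ * d₂ ^ 2 * d₄ - (64 / 3 : ℝ) * d₀ * d₂ * d₄ * el -
    (22 / 3 : ℝ) * d₀ * d₂ * k₂ ^ 2 - 88 * d₀ * d₄ * k₀ * k₂ + 2 * d₀ * d₄ * el ^ 2 -
    5 * d₀ * k₂ ^ 2 * el + (40 / 3 : ℝ) * d₁ ^ 2 * d₂ * d₄ - (43 / 4 : ℝ) * d₁ ^ 2 * d₄ * el +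
    (21 / 4 : ℝ) * d₁ ^ 2 * k₂ ^ 2 + (10 / 9 : ℝ) * d₂ ^ 4 - (11 / 3 : ℝ) * d₂ ^ 3 * el +
    (82 / 3 : ℝ) * d₂ ^ 2 * k₀ * k₂ + d₂ ^ 2 * el ^ 2 + (458 / 3 : ℝ) * d₂ * d₄ * k₀ ^ 2 -
    10 * d₂ * k₀ * k₂ * el - 5 * d₄ * k₀ ^ 2 * el + 24 * k₀ ^ 2 * k₂ ^ 2) * r ^ 4 +
    (8 * d₀ * d₁ * d₄ ^ 2 + (62 / 9 : ℝ) * d₁ * d₂ ^ 2 * d₄ - (91 / 3 : ℝ) * d₁ * d₂ * d₄ * el +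
    (5 / 3 : ℝ) * d₁ * d₂ * k₂ ^ 2 + 32 * d₁ * d₄ * k₀ * k₂ + 2 * d₁ * d₄ * el ^ 2 -
    5 * d₁ * k₂ ^ 2 * el) * r ^ 5 + (-(280 / 3 : ℝ) * d₀ * d₂ * d₄ ^ 2 - 20 * d₀ * d₄ ^ 2 * el -
    60 * d₀ * d₄ * k₂ ^ 2 + 10 * d₁ ^ 2 * d₄ ^ 2 + (50 / 9 : ℝ) * d₂ ^ 3 * d₄ -
    (61 / 3 : ℝ) * d₂ ^ 2 * d₄ * el + (17 / 3 : ℝ) * d₂ ^ 2 * k₂ ^ 2 +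
    (460 / 3 : ℝ) * d₂ * d₄ * k₀ * k₂ + 2 * d₂ * d₄ * el ^ 2 - 5 * d₂ * k₂ ^ 2 * el +
    152 * d₄ ^ 2 * k₀ ^ 2 - 10 * d₄ * k₀ * k₂ * el + 16 * k₀ * k₂ ^ 3) * r ^ 6 +
    (-(40 / 3 : ℝ) * d₁ * d₂ * d₄ ^ 2 - 26 * d₁ * d₄ ^ 2 * el - 14 * d₁ * d₄ * k₂ ^ 2) * r ^ 7 +
    (-100 * d₀ * d₄ ^ 3 + (25 / 9 : ℝ) * d₂ ^ 2 * d₄ ^ 2 - (98 / 3 : ℝ) * d₂ * d₄ ^ 2 * el +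
    (98 / 3 : ℝ) * d₂ * d₄ * k₂ ^ 2 + 200 * d₄ ^ 2 * k₀ * k₂ + d₄ ^ 2 * el ^ 2 -
    5 * d₄ * k₂ ^ 2 * el + 4 * k₂ ^ 4) * r ^ 8 + (-40 * d₁ * d₄ ^ 3) * r ^ 9 +
    (-(32 / 3 : ℝ) * d₂ * d₄ ^ 3 - 16 * d₄ ^ 3 * el + 64 * d₄ ^ 2 * k₂ ^ 2) * r ^ 10

/-- The `r`-derivative of `tsqP11`, written out as a polynomial (`hasDerivAt_tsqP11`). [cite:
WuYan2004, Appendix A, (A5)] -/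
def tsqP11d (d₀ d₁ d₂ d₄ k₀ k₂ el r : ℝ) : ℝ :=
  (-(70 / 9 : ℝ) * d₀ * d₁ * d₂ ^ 2 - (13 / 3 : ℝ) * d₀ * d₁ * d₂ * el - 12 * d₀ * d₁ * k₀ * k₂ +
    2 * d₀ * d₁ * el ^ 2 + (5 / 2 : ℝ) * d₁ ^ 3 * d₂ - (3 / 4 : ℝ) * d₁ ^ 3 * el +
    (113 / 3 : ℝ) * d₁ * d₂ * k₀ ^ 2 - 5 * d₁ * k₀ ^ 2 * el) +
    2 * ((40 / 3 : ℝ) * d₀ ^ 2 * d₂ * d₄ - 4 * d₀ ^ 2 * d₄ * el + 24 * d₀ ^ 2 * k₂ ^ 2 -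
    (70 / 9 : ℝ) * d₀ * d₂ ^ 3 - (13 / 3 : ℝ) * d₀ * d₂ ^ 2 * el -
    (116 / 3 : ℝ) * d₀ * d₂ * k₀ * k₂ + 2 * d₀ * d₂ * el ^ 2 + 4 * d₀ * d₄ * k₀ ^ 2 -
    10 * d₀ * k₀ * k₂ * el + (65 / 18 : ℝ) * d₁ ^ 2 * d₂ ^ 2 - (53 / 12 : ℝ) * d₁ ^ 2 * d₂ * el -
    (3 / 2 : ℝ) * d₁ ^ 2 * k₀ * k₂ + d₁ ^ 2 * el ^ 2 + (113 / 3 : ℝ) * d₂ ^ 2 * k₀ ^ 2 -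
    5 * d₂ * k₀ ^ 2 * el + 16 * k₀ ^ 3 * k₂) * r + 3 * (-(40 / 3 : ℝ) * d₀ * d₁ * d₂ * d₄ -
    14 * d₀ * d₁ * d₄ * el + 20 * d₀ * d₁ * k₂ ^ 2 + 5 * d₁ ^ 3 * d₄ + (20 / 9 : ℝ) * d₁ * d₂ ^ 3 -
    (22 / 3 : ℝ) * d₁ * d₂ ^ 2 * el + (22 / 3 : ℝ) * d₁ * d₂ * k₀ * k₂ + 2 * d₁ * d₂ * el ^ 2 +
    78 * d₁ * d₄ * k₀ ^ 2 - 10 * d₁ * k₀ * k₂ * el) * r ^ 2 + 4 * (40 * d₀ ^ 2 * d₄ ^ 2 -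
    (370 / 9 : ℝ) * d₀ * d₂ ^ 2 * d₄ - (64 / 3 : ℝ) * d₀ * d₂ * d₄ * el -
    (22 / 3 : ℝ) * d₀ * d₂ * k₂ ^ 2 - 88 * d₀ * d₄ * k₀ * k₂ + 2 * d₀ * d₄ * el ^ 2 -
    5 * d₀ * k₂ ^ 2 * el + (40 / 3 : ℝ) * d₁ ^ 2 * d₂ * d₄ - (43 / 4 : ℝ) * d₁ ^ 2 * d₄ * el +
    (21 / 4 : ℝ) * d₁ ^ 2 * k₂ ^ 2 + (10 / 9 : ℝ) * d₂ ^ 4 - (11 / 3 : ℝ) * d₂ ^ 3 * el +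
    (82 / 3 : ℝ) * d₂ ^ 2 * k₀ * k₂ + d₂ ^ 2 * el ^ 2 + (458 / 3 : ℝ) * d₂ * d₄ * k₀ ^ 2 -
    10 * d₂ * k₀ * k₂ * el - 5 * d₄ * k₀ ^ 2 * el + 24 * k₀ ^ 2 * k₂ ^ 2) * r ^ 3 +
    5 * (8 * d₀ * d₁ * d₄ ^ 2 + (62 / 9 : ℝ) * d₁ * d₂ ^ 2 * d₄ - (91 / 3 : ℝ) * d₁ * d₂ * d₄ * el +
    (5 / 3 : ℝ) * d₁ * d₂ * k₂ ^ 2 + 32 * d₁ * d₄ * k₀ * k₂ + 2 * d₁ * d₄ * el ^ 2 -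
    5 * d₁ * k₂ ^ 2 * el) * r ^ 4 + 6 * (-(280 / 3 : ℝ) * d₀ * d₂ * d₄ ^ 2 - 20 * d₀ * d₄ ^ 2 * el -
    60 * d₀ * d₄ * k₂ ^ 2 + 10 * d₁ ^ 2 * d₄ ^ 2 + (50 / 9 : ℝ) * d₂ ^ 3 * d₄ -
    (61 / 3 : ℝ) * d₂ ^ 2 * d₄ * el + (17 / 3 : ℝ) * d₂ ^ 2 * k₂ ^ 2 +
    (460 / 3 : ℝ) * d₂ * d₄ * k₀ * k₂ + 2 * d₂ * d₄ * el ^ 2 - 5 * d₂ * k₂ ^ 2 * el +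
    152 * d₄ ^ 2 * k₀ ^ 2 - 10 * d₄ * k₀ * k₂ * el + 16 * k₀ * k₂ ^ 3) * r ^ 5 +
    7 * (-(40 / 3 : ℝ) * d₁ * d₂ * d₄ ^ 2 - 26 * d₁ * d₄ ^ 2 * el - 14 * d₁ * d₄ * k₂ ^ 2) * r ^ 6 +
    8 * (-100 * d₀ * d₄ ^ 3 + (25 / 9 : ℝ) * d₂ ^ 2 * d₄ ^ 2 - (98 / 3 : ℝ) * d₂ * d₄ ^ 2 * el +
    (98 / 3 : ℝ) * d₂ * d₄ * k₂ ^ 2 + 200 * d₄ ^ 2 * k₀ * k₂ + d₄ ^ 2 * el ^ 2 -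
    5 * d₄ * k₂ ^ 2 * el + 4 * k₂ ^ 4) * r ^ 7 + 9 * (-40 * d₁ * d₄ ^ 3) * r ^ 8 +
    10 * (-(32 / 3 : ℝ) * d₂ * d₄ ^ 3 - 16 * d₄ ^ 3 * el + 64 * d₄ ^ 2 * k₂ ^ 2) * r ^ 9

/-! ### Derivatives of the polynomial data -/

/-- `d/dx x^{n+1} = (n+1)xⁿ` with the exponent already reduced (private plumbing). [folklore] -/
private theorem hasDerivAt_powS (n : ℕ) (r : ℝ) :
    HasDerivAt (fun x : ℝ => x ^ (n + 1)) ((n + 1 : ℝ) * r ^ n) r := by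
  simpa using hasDerivAt_pow (n + 1) r

/-- Derivative of an explicit polynomial of degree `4` (private plumbing). [folklore] -/
private theorem hasDerivAt_poly4 (c₀ c₁ c₂ c₃ c₄ r : ℝ) :
    HasDerivAt (fun x => c₀ + c₁ * x + c₂ * x ^ 2 + c₃ * x ^ 3 + c₄ * x ^ 4)
      (c₁ + 2 * c₂ * r + 3 * c₃ * r ^ 2 + 4 * c₄ * r ^ 3) r := by
  have h := ((((hasDerivAt_const r c₀).fun_add ((hasDerivAt_id' r).const_mul c₁)).fun_add
    ((hasDerivAt_powS 1 r).const_mul c₂)).fun_add ((hasDerivAt_powS 2 r).const_mul c₃)).fun_add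
    ((hasDerivAt_powS 3 r).const_mul c₄)
  refine h.congr_deriv ?_
  push_cast
  ring

/-- Derivative of an explicit polynomial of degree `6` (private plumbing). [folklore] -/
private theorem hasDerivAt_poly6 (c₀ c₁ c₂ c₃ c₄ c₅ c₆ r : ℝ) :
    HasDerivAt (fun x => c₀ + c₁ * x + c₂ * x ^ 2 + c₃ * x ^ 3 + c₄ * x ^ 4 + c₅ * x ^ 5 +
        c₆ * x ^ 6)
      (c₁ + 2 * c₂ * r + 3 * c₃ * r ^ 2 + 4 * c₄ * r ^ 3 + 5 * c₅ * r ^ 4 + 6 * c₆ * r ^ 5) r := by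
  have h := ((((((hasDerivAt_const r c₀).fun_add ((hasDerivAt_id' r).const_mul c₁)).fun_add
    ((hasDerivAt_powS 1 r).const_mul c₂)).fun_add ((hasDerivAt_powS 2 r).const_mul c₃)).fun_add
    ((hasDerivAt_powS 3 r).const_mul c₄)).fun_add ((hasDerivAt_powS 4 r).const_mul c₅)).fun_add
    ((hasDerivAt_powS 5 r).const_mul c₆)
  refine h.congr_deriv ?_
  push_cast
  ring

/-- Derivative of an explicit polynomial of degree `7` (private plumbing). [folklore] -/
private theorem hasDerivAt_poly7 (c₀ c₁ c₂ c₃ c₄ c₅ c₆ c₇ r : ℝ) :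
    HasDerivAt (fun x => c₀ + c₁ * x + c₂ * x ^ 2 + c₃ * x ^ 3 + c₄ * x ^ 4 + c₅ * x ^ 5 +
        c₆ * x ^ 6 + c₇ * x ^ 7)
      (c₁ + 2 * c₂ * r + 3 * c₃ * r ^ 2 + 4 * c₄ * r ^ 3 + 5 * c₅ * r ^ 4 + 6 * c₆ * r ^ 5 +
        7 * c₇ * r ^ 6) r := by
  have h := (((((((hasDerivAt_const r c₀).fun_add ((hasDerivAt_id' r).const_mul c₁)).fun_add
    ((hasDerivAt_powS 1 r).const_mul c₂)).fun_add ((hasDerivAt_powS 2 r).const_mul c₃)).fun_add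
    ((hasDerivAt_powS 3 r).const_mul c₄)).fun_add ((hasDerivAt_powS 4 r).const_mul c₅)).fun_add
    ((hasDerivAt_powS 5 r).const_mul c₆)).fun_add ((hasDerivAt_powS 6 r).const_mul c₇)
  refine h.congr_deriv ?_
  push_cast
  ring

/-- Derivative of an explicit polynomial of degree `10` (private plumbing). [folklore] -/
private theorem hasDerivAt_poly10 (c₀ c₁ c₂ c₃ c₄ c₅ c₆ c₇ c₈ c₉ c₁₀ r : ℝ) :
    HasDerivAt (fun x => c₀ + c₁ * x + c₂ * x ^ 2 + c₃ * x ^ 3 + c₄ * x ^ 4 + c₅ * x ^ 5 +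
        c₆ * x ^ 6 + c₇ * x ^ 7 + c₈ * x ^ 8 + c₉ * x ^ 9 + c₁₀ * x ^ 10)
      (c₁ + 2 * c₂ * r + 3 * c₃ * r ^ 2 + 4 * c₄ * r ^ 3 + 5 * c₅ * r ^ 4 + 6 * c₆ * r ^ 5 +
        7 * c₇ * r ^ 6 + 8 * c₈ * r ^ 7 + 9 * c₉ * r ^ 8 + 10 * c₁₀ * r ^ 9) r := by
  have h := ((((((((((hasDerivAt_const r c₀).fun_add ((hasDerivAt_id' r).const_mul c₁)).fun_add
    ((hasDerivAt_powS 1 r).const_mul c₂)).fun_add ((hasDerivAt_powS 2 r).const_mul c₃)).fun_add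
    ((hasDerivAt_powS 3 r).const_mul c₄)).fun_add ((hasDerivAt_powS 4 r).const_mul c₅)).fun_add
    ((hasDerivAt_powS 5 r).const_mul c₆)).fun_add ((hasDerivAt_powS 6 r).const_mul c₇)).fun_add
    ((hasDerivAt_powS 7 r).const_mul c₈)).fun_add ((hasDerivAt_powS 8 r).const_mul c₉)).fun_add
    ((hasDerivAt_powS 9 r).const_mul c₁₀)
  refine h.congr_deriv ?_
  push_cast
  ring

/-- `Δ′` is the derivative of `Δ`. [cite: Hatsuda2020, (2.13)] -/
theorem hasDerivAt_tsqDelta (d₀ d₁ d₂ d₄ r : ℝ) :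
    HasDerivAt (fun x => tsqDelta d₀ d₁ d₂ d₄ x) (tsqDeltaD d₁ d₂ d₄ r) r := by
  have h := hasDerivAt_poly4 d₀ d₁ d₂ 0 d₄ r
  have hf : (fun x => d₀ + d₁ * x + d₂ * x ^ 2 + 0 * x ^ 3 + d₄ * x ^ 4) =
      fun x => tsqDelta d₀ d₁ d₂ d₄ x := by
    funext x; simp only [tsqDelta]; ring
  rw [hf] at h
  refine h.congr_deriv ?_
  simp only [tsqDeltaD]
  ring

/-- `p₂₂′` is the derivative of `p₂₂`. [cite: WuYan2004, Appendix A, (A5)] -/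
theorem hasDerivAt_tsqP22 (d₀ d₁ d₂ d₄ k₀ k₂ el r : ℝ) :
    HasDerivAt (fun x => tsqP22 d₀ d₁ d₂ d₄ k₀ k₂ el x) (tsqP22d d₀ d₁ d₂ d₄ k₀ k₂ el r) r := by
  unfold tsqP22 tsqP22d
  exact hasDerivAt_poly4 _ _ _ _ _ r

/-- `(Re p₁₂)′` is the derivative of `Re p₁₂`. [cite: WuYan2004, Appendix A, (A5)] -/
theorem hasDerivAt_tsqP12re (d₀ d₁ d₂ d₄ k₀ k₂ el r : ℝ) :
    HasDerivAt (fun x => tsqP12re d₀ d₁ d₂ d₄ k₀ k₂ el x) (tsqP12red d₀ d₁ d₂ d₄ k₀ k₂ el r) r := by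
  unfold tsqP12re tsqP12red
  exact hasDerivAt_poly7 _ _ _ _ _ _ _ _ r

/-- `(Im p₁₂)′` is the derivative of `Im p₁₂`. [cite: WuYan2004, Appendix A, (A5)] -/
theorem hasDerivAt_tsqP12im (d₀ d₁ d₂ d₄ k₀ k₂ el r : ℝ) :
    HasDerivAt (fun x => tsqP12im d₀ d₁ d₂ d₄ k₀ k₂ el x) (tsqP12imd d₀ d₁ d₂ d₄ k₀ k₂ el r) r := by
  unfold tsqP12im tsqP12imd
  exact hasDerivAt_poly6 _ _ _ _ _ _ _ r

/-- `p₁₁′` is the derivative of `p₁₁`. [cite: WuYan2004, Appendix A, (A5)] -/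
theorem hasDerivAt_tsqP11 (d₀ d₁ d₂ d₄ k₀ k₂ el r : ℝ) :
    HasDerivAt (fun x => tsqP11 d₀ d₁ d₂ d₄ k₀ k₂ el x) (tsqP11d d₀ d₁ d₂ d₄ k₀ k₂ el r) r := by
  unfold tsqP11 tsqP11d
  exact hasDerivAt_poly10 _ _ _ _ _ _ _ _ _ _ _ r

/-! ### The four polynomial identities behind `W′ = 0` -/

/-- **(P3)**, the `|R′|²`-coefficient of `W′`: `2 Re p₁₂ + Δ·p₂₂′ = 3Δ′·p₂₂`.
[cite: WuYan2004, Appendix A, (A5)] -/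
theorem tsq_identity_P3 (d₀ d₁ d₂ d₄ k₀ k₂ el r : ℝ) :
    2 * tsqP12re d₀ d₁ d₂ d₄ k₀ k₂ el r + tsqDelta d₀ d₁ d₂ d₄ r * tsqP22d d₀ d₁ d₂ d₄ k₀ k₂ el r =
      3 * tsqDeltaD d₁ d₂ d₄ r * tsqP22 d₀ d₁ d₂ d₄ k₀ k₂ el r := by
  unfold tsqP12re tsqDelta tsqP22d tsqDeltaD tsqP22
  ring

/-- **(P2), real part**, from the `R·conj R′`-coefficient of `W′`:
`p₁₁ + Δ·(Re p₁₂)′ = (3/2)Δ′·Re p₁₂ + p₂₂·Re N_V`. [cite: WuYan2004, Appendix A, (A5)] -/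
theorem tsq_identity_P2re (d₀ d₁ d₂ d₄ k₀ k₂ el r : ℝ) :
    tsqP11 d₀ d₁ d₂ d₄ k₀ k₂ el r + tsqDelta d₀ d₁ d₂ d₄ r * tsqP12red d₀ d₁ d₂ d₄ k₀ k₂ el r =
      3 / 2 * tsqDeltaD d₁ d₂ d₄ r * tsqP12re d₀ d₁ d₂ d₄ k₀ k₂ el r +
        tsqP22 d₀ d₁ d₂ d₄ k₀ k₂ el r * tsqNVre d₀ d₁ d₂ d₄ k₀ k₂ el r := by
  unfold tsqP11 tsqDelta tsqP12red tsqDeltaD tsqP12re tsqP22 tsqNVre tsqK tsqDeltaDD tsqDelta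
  ring

/-- **(P2), imaginary part**: `Δ·(Im p₁₂)′ = (3/2)Δ′·Im p₁₂ + p₂₂·Im N_V`.
[cite: WuYan2004, Appendix A, (A5)] -/
theorem tsq_identity_P2im (d₀ d₁ d₂ d₄ k₀ k₂ el r : ℝ) :
    tsqDelta d₀ d₁ d₂ d₄ r * tsqP12imd d₀ d₁ d₂ d₄ k₀ k₂ el r =
      3 / 2 * tsqDeltaD d₁ d₂ d₄ r * tsqP12im d₀ d₁ d₂ d₄ k₀ k₂ el r +
        tsqP22 d₀ d₁ d₂ d₄ k₀ k₂ el r * tsqNVim d₀ d₁ d₂ d₄ k₀ k₂ r := by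
  unfold tsqDelta tsqP12imd tsqDeltaD tsqP12im tsqP22 tsqNVim tsqK tsqDeltaD tsqDelta
  ring

/-- **(P1)**, the `|R|²`-coefficient of `W′`: `Δ·p₁₁′ = 2(Re p₁₂·Re N_V + Im p₁₂·Im N_V)`
(`= 2 Re(p₁₂·conj N_V)`). [cite: WuYan2004, Appendix A, (A5)] -/
theorem tsq_identity_P1 (d₀ d₁ d₂ d₄ k₀ k₂ el r : ℝ) :
    tsqDelta d₀ d₁ d₂ d₄ r * tsqP11d d₀ d₁ d₂ d₄ k₀ k₂ el r =
      2 * (tsqP12re d₀ d₁ d₂ d₄ k₀ k₂ el r * tsqNVre d₀ d₁ d₂ d₄ k₀ k₂ el r +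
        tsqP12im d₀ d₁ d₂ d₄ k₀ k₂ el r * tsqNVim d₀ d₁ d₂ d₄ k₀ k₂ r) := by
  unfold tsqDelta tsqP11d tsqP12re tsqNVre tsqP12im tsqNVim tsqK tsqDeltaDD tsqDeltaD tsqDelta
  ring

end Literature.Geometry.Lorentzian.KerrDeSitter

end
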